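import Mathlib.Data.Real.Basic
import Mathlib.Tactic.Linarith
import Mathlib.Tactic.Ring
import Mathlib.Tactic.Positivity
import HarnessLib

/-!
# `NoHeavyLowerTail` (stmt-CriticalPhenomena-4575) — BERNSTEIN form of the one-coordinate step for the cubic
# sunflower inequality (lattice AG⁺), and the step from a BERNSTEIN-GOOD coordinate

Support file (certificate seat `prim-cert-1` gen 3; `--supports stmt-CriticalPhenomena-4575`).  No definitions, no named
facts, no sorries; pure real arithmetic.  Companion of
`…PercNearOneGluingNoHeavyLowerTailSunflowerCubicStep` (prove-4): same twelve refined-slice variables of one coordinate with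
parameter `p` (core masses `a₀`, `a₁ = a₀ + d + Σ cp`, outside `q₀ = b₀ + d + Σ cm`, `q₁ = b₀`, slice petal masses
`x i = co i + cp i`, `y i = co i + cm i`, law at `p` = convex combination), functional `Φ(t;u;q) = t q − e₂(u) − e₃(u)`.

Why this file: the hypothesis EXISTS-GOOD-COORDINATE of `SunflowerCubic.core` (`L_e ≥ 0`, i.e. `Φ(law p)` above the chord) is
FALSE (prove-4, 2026-08-19: the hexagon system `MAJ ∘ (AND, AND, AND)` at `p = 1/3` has `L_e = −10688/3¹⁶` at every coordinate).
The induction survives with the weaker, natural notion of a BERNSTEIN-GOOD coordinate: writing `Φ(law p)` as a cubic in `p` in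
Bernstein form,

  `Φ(law p) = (1−p)³ Φ₀ + 3p(1−p)² B₁ + 3p²(1−p) B₂ + p³ Φ₁`,
  `3 B₁ = 2·AG₀ + AG₁ + Γ − (x₁x₂y₃ + x₁y₂x₃ + y₁x₂x₃)`,  `3 B₂ = AG₀ + 2·AG₁ + Γ − (x₁y₂y₃ + y₁x₂y₃ + y₁y₂x₃)`,

where `AG₀ = a₀q₀ − e₂(x)`, `AG₁ = a₁q₁ − e₂(y)` are Gladkov's (nonnegative) strong-Harris slacks of the two slices and
`Γ = αβ + e₂(δ)` (`α = d + Σ cp`, `β = d + Σ cm`, `δ i = cm i − cp i`) is the (nonnegative) concavity term of Gladkov's induction;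
a coordinate is BERNSTEIN-GOOD if `B₁ ≥ 0 ∧ B₂ ≥ 0`, and then the induction hypotheses `Φ₀, Φ₁ ≥ 0` give `Φ(law p) ≥ 0` on `[0,1]`.
At the hexagon every coordinate is Bernstein-good (`B₁ = +2.3·10⁻⁴`, `B₂ = +6.6·10⁻⁴`); Bernstein-goodness of EVERY coordinate is
implied by three-copy fibre positivity of `Φ` (census-exhaustive on ≤ 5 coordinates) — memo
`run/shared/lean/prim/prim-ineq-prove-4/FROM-prim-cert-1-gen3-BERNSTEIN-GOOD.md`.

* `SunflowerCubicBernstein.bernstein_identity` — the displayed identity (by `ring`);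
* `SunflowerCubicBernstein.three_B₁_eq`, `three_B₂_eq` — `3B₁ = 2Φ₀ + Φ₁ + K₀`, `3B₂ = Φ₀ + 2Φ₁ + K₁` with `K₀, K₁` the endpoint
  values of the bracket of `SunflowerCubicStep.step_identity` (so `L_e = (1−p)K₀ + pK₁`);
* `SunflowerCubicBernstein.cubic_bernstein_nonneg` / `step_of_bernsteinGood` — nonnegative Bernstein coefficients give a
  nonnegative cubic on `[0,1]`, hence the step.
-/

namespace Summit.CriticalPhenomena.PercolationContinuityZ3.Theorems

namespace SunflowerCubicBernstein

/-- **Bernstein form of the one-coordinate identity for `Φ = tq − e₂ − e₃`.**  In the refined-slice variables (module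
docstring): `Φ(law p) = (1−p)³Φ₀ + 3p(1−p)²B₁ + 3p²(1−p)B₂ + p³Φ₁` with
`3B₁ = 2AG₀ + AG₁ + Γ − (x₁x₂y₃ + x₁y₂x₃ + y₁x₂x₃)` and `3B₂ = AG₀ + 2AG₁ + Γ − (x₁y₂y₃ + y₁x₂y₃ + y₁y₂x₃)`.
[cite: Gladkov2024StrongFKG, proof of Thm. 2.1 (the quadratic part); this file (cubic part, Bernstein form)] -/
theorem bernstein_identity (p a₀ b₀ d cp₁ cp₂ cp₃ co₁ co₂ co₃ cm₁ cm₂ cm₃ : ℝ) :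
    let pb := 1 - p
    let a₁ := a₀ + d + (cp₁ + cp₂ + cp₃)
    let q₀ := b₀ + d + (cm₁ + cm₂ + cm₃)
    let q₁ := b₀
    let x₁ := co₁ + cp₁
    let x₂ := co₂ + cp₂
    let x₃ := co₃ + cp₃
    let y₁ := co₁ + cm₁
    let y₂ := co₂ + cm₂
    let y₃ := co₃ + cm₃
    let t := pb * a₀ + p * a₁
    let q := pb * q₀ + p * q₁
    let u₁ := pb * x₁ + p * y₁
    let u₂ := pb * x₂ + p * y₂
    let u₃ := pb * x₃ + p * y₃
    let α := d + (cp₁ + cp₂ + cp₃)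
    let β := d + (cm₁ + cm₂ + cm₃)
    let δ₁ := cm₁ - cp₁
    let δ₂ := cm₂ - cp₂
    let δ₃ := cm₃ - cp₃
    let AG₀ := a₀ * q₀ - (x₁ * x₂ + x₁ * x₃ + x₂ * x₃)
    let AG₁ := a₁ * q₁ - (y₁ * y₂ + y₁ * y₃ + y₂ * y₃)
    let Φ₀ := AG₀ - x₁ * x₂ * x₃
    let Φ₁ := AG₁ - y₁ * y₂ * y₃
    let Γ := α * β + (δ₁ * δ₂ + δ₁ * δ₃ + δ₂ * δ₃)
    let B₁ := (2 * AG₀ + AG₁ + Γ - (x₁ * x₂ * y₃ + x₁ * y₂ * x₃ + y₁ * x₂ * x₃)) / 3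
    let B₂ := (AG₀ + 2 * AG₁ + Γ - (x₁ * y₂ * y₃ + y₁ * x₂ * y₃ + y₁ * y₂ * x₃)) / 3
    t * q - (u₁ * u₂ + u₁ * u₃ + u₂ * u₃) - u₁ * u₂ * u₃ =
      pb ^ 3 * Φ₀ + 3 * p * pb ^ 2 * B₁ + 3 * p ^ 2 * pb * B₂ + p ^ 3 * Φ₁ := by
  intro pb a₁ q₀ q₁ x₁ x₂ x₃ y₁ y₂ y₃ t q u₁ u₂ u₃ α β δ₁ δ₂ δ₃ AG₀ AG₁ Φ₀ Φ₁ Γ B₁ B₂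
  simp only [pb, a₁, q₀, q₁, x₁, x₂, x₃, y₁, y₂, y₃, t, q, u₁, u₂, u₃, α, β, δ₁, δ₂, δ₃, AG₀, AG₁, Φ₀, Φ₁, Γ, B₁, B₂]
  ring

/-- **`3B₁ = 2Φ₀ + Φ₁ + K₀`**: the first inner Bernstein coefficient in terms of the slice values and the `p = 0` endpoint
`K₀ = Γ + Σ_m x_m δ_i δ_j + δ₁δ₂δ₃` of the bracket of `SunflowerCubicStep.step_identity` (whose bracket is `(1−p)K₀ + pK₁`).
[this file] -/
theorem three_B₁_eq (a₀ b₀ d cp₁ cp₂ cp₃ co₁ co₂ co₃ cm₁ cm₂ cm₃ : ℝ) :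
    let a₁ := a₀ + d + (cp₁ + cp₂ + cp₃)
    let q₀ := b₀ + d + (cm₁ + cm₂ + cm₃)
    let q₁ := b₀
    let x₁ := co₁ + cp₁
    let x₂ := co₂ + cp₂
    let x₃ := co₃ + cp₃
    let y₁ := co₁ + cm₁
    let y₂ := co₂ + cm₂
    let y₃ := co₃ + cm₃
    let α := d + (cp₁ + cp₂ + cp₃)
    let β := d + (cm₁ + cm₂ + cm₃)
    let δ₁ := cm₁ - cp₁
    let δ₂ := cm₂ - cp₂
    let δ₃ := cm₃ - cp₃
    let AG₀ := a₀ * q₀ - (x₁ * x₂ + x₁ * x₃ + x₂ * x₃)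
    let AG₁ := a₁ * q₁ - (y₁ * y₂ + y₁ * y₃ + y₂ * y₃)
    let Φ₀ := AG₀ - x₁ * x₂ * x₃
    let Φ₁ := AG₁ - y₁ * y₂ * y₃
    let Γ := α * β + (δ₁ * δ₂ + δ₁ * δ₃ + δ₂ * δ₃)
    let K₀ := Γ + (x₃ * (δ₁ * δ₂) + x₂ * (δ₁ * δ₃) + x₁ * (δ₂ * δ₃)) + δ₁ * δ₂ * δ₃
    2 * AG₀ + AG₁ + Γ - (x₁ * x₂ * y₃ + x₁ * y₂ * x₃ + y₁ * x₂ * x₃) = 2 * Φ₀ + Φ₁ + K₀ := by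
  intro a₁ q₀ q₁ x₁ x₂ x₃ y₁ y₂ y₃ α β δ₁ δ₂ δ₃ AG₀ AG₁ Φ₀ Φ₁ Γ K₀
  simp only [a₁, q₀, q₁, x₁, x₂, x₃, y₁, y₂, y₃, α, β, δ₁, δ₂, δ₃, AG₀, AG₁, Φ₀, Φ₁, Γ, K₀]
  ring

/-- **`3B₂ = Φ₀ + 2Φ₁ + K₁`**: the second inner Bernstein coefficient in terms of the slice values and the `p = 1` endpoint
`K₁ = Γ + Σ_m y_m δ_i δ_j − δ₁δ₂δ₃` of the bracket of `SunflowerCubicStep.step_identity`. [this file] -/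
theorem three_B₂_eq (a₀ b₀ d cp₁ cp₂ cp₃ co₁ co₂ co₃ cm₁ cm₂ cm₃ : ℝ) :
    let a₁ := a₀ + d + (cp₁ + cp₂ + cp₃)
    let q₀ := b₀ + d + (cm₁ + cm₂ + cm₃)
    let q₁ := b₀
    let x₁ := co₁ + cp₁
    let x₂ := co₂ + cp₂
    let x₃ := co₃ + cp₃
    let y₁ := co₁ + cm₁
    let y₂ := co₂ + cm₂
    let y₃ := co₃ + cm₃
    let α := d + (cp₁ + cp₂ + cp₃)
    let β := d + (cm₁ + cm₂ + cm₃)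
    let δ₁ := cm₁ - cp₁
    let δ₂ := cm₂ - cp₂
    let δ₃ := cm₃ - cp₃
    let AG₀ := a₀ * q₀ - (x₁ * x₂ + x₁ * x₃ + x₂ * x₃)
    let AG₁ := a₁ * q₁ - (y₁ * y₂ + y₁ * y₃ + y₂ * y₃)
    let Φ₀ := AG₀ - x₁ * x₂ * x₃
    let Φ₁ := AG₁ - y₁ * y₂ * y₃
    let Γ := α * β + (δ₁ * δ₂ + δ₁ * δ₃ + δ₂ * δ₃)
    let K₁ := Γ + (y₃ * (δ₁ * δ₂) + y₂ * (δ₁ * δ₃) + y₁ * (δ₂ * δ₃)) - δ₁ * δ₂ * δ₃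
    AG₀ + 2 * AG₁ + Γ - (x₁ * y₂ * y₃ + y₁ * x₂ * y₃ + y₁ * y₂ * x₃) = Φ₀ + 2 * Φ₁ + K₁ := by
  intro a₁ q₀ q₁ x₁ x₂ x₃ y₁ y₂ y₃ α β δ₁ δ₂ δ₃ AG₀ AG₁ Φ₀ Φ₁ Γ K₁
  simp only [a₁, q₀, q₁, x₁, x₂, x₃, y₁, y₂, y₃, α, β, δ₁, δ₂, δ₃, AG₀, AG₁, Φ₀, Φ₁, Γ, K₁]
  ring

/-- A cubic with nonnegative Bernstein coefficients is nonnegative on `[0,1]`. [folklore] -/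
theorem cubic_bernstein_nonneg {p c₀ c₁ c₂ c₃ : ℝ} (hp0 : 0 ≤ p) (hp1 : p ≤ 1) (h0 : 0 ≤ c₀) (h1 : 0 ≤ c₁)
    (h2 : 0 ≤ c₂) (h3 : 0 ≤ c₃) :
    0 ≤ (1 - p) ^ 3 * c₀ + 3 * p * (1 - p) ^ 2 * c₁ + 3 * p ^ 2 * (1 - p) * c₂ + p ^ 3 * c₃ := by
  have hpb : 0 ≤ 1 - p := by linarith
  positivity

/-- **A Bernstein-good coordinate makes the step.**  If both slice systems satisfy the cubic inequality (`Φ₀, Φ₁ ≥ 0`, the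
induction hypotheses) and the two inner Bernstein coefficients `B₁, B₂` of `bernstein_identity` are nonnegative ("the
coordinate is Bernstein-good"), then the mixed law satisfies `Φ ≥ 0` for every `p ∈ [0,1]`.  This replaces
`SunflowerCubicStep.step_of_good`, whose hypothesis `L ≥ 0` can fail at every coordinate (hexagon system). [this file] -/
theorem step_of_bernsteinGood {p Φ₀ Φ₁ B₁ B₂ Φ : ℝ} (hp0 : 0 ≤ p) (hp1 : p ≤ 1) (h0 : 0 ≤ Φ₀) (h1 : 0 ≤ Φ₁)
    (hB1 : 0 ≤ B₁) (hB2 : 0 ≤ B₂)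
    (hid : Φ = (1 - p) ^ 3 * Φ₀ + 3 * p * (1 - p) ^ 2 * B₁ + 3 * p ^ 2 * (1 - p) * B₂ + p ^ 3 * Φ₁) : 0 ≤ Φ := by
  rw [hid]
  exact cubic_bernstein_nonneg hp0 hp1 h0 hB1 hB2 h1

/-- **A good coordinate is Bernstein-good up to the IH slack** (the converse direction fails): if the bracket endpoints satisfy
`K₀ ≥ −(2Φ₀ + Φ₁)` and `K₁ ≥ −(Φ₀ + 2Φ₁)` then `B₁, B₂ ≥ 0`; in particular `K₀, K₁ ≥ 0` (every `p` good) together with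
`Φ₀, Φ₁ ≥ 0` suffices. [this file] -/
theorem bernsteinGood_of_bracket {Φ₀ Φ₁ K₀ K₁ B₁ B₂ : ℝ} (hB1 : 3 * B₁ = 2 * Φ₀ + Φ₁ + K₀)
    (hB2 : 3 * B₂ = Φ₀ + 2 * Φ₁ + K₁) (hK0 : -(2 * Φ₀ + Φ₁) ≤ K₀) (hK1 : -(Φ₀ + 2 * Φ₁) ≤ K₁) :
    0 ≤ B₁ ∧ 0 ≤ B₂ := by
  constructor <;> linarith


/-! ## The same Bernstein form for the regime functionals `Ha = t·AG − e₃`, `Hb = q·AG − e₃` and for `Hqt = (t+q)·AG − e₃`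

For a homogeneous cubic `F = c·(tq − e₂(u)) − e₃(u)` with `c` a fixed linear form of the law (`c = t`, `q`, `t+q`), the inner
Bernstein coefficients of `F(law p)` are
`3B₁ = (c₀+c₁)AG₀ + c₀AG₁ + c₀Γ − M₁`, `3B₂ = c₁AG₀ + (c₀+c₁)AG₁ + c₁Γ − M₂`
(`c₀, c₁` the values of `c` on the two slices; `M₁ = x₁x₂y₃ + x₁y₂x₃ + y₁x₂x₃`, `M₂ = x₁y₂y₃ + y₁x₂y₃ + y₁y₂x₃`).  These are the
objects of the piecewise (regime-split) Bernstein criterion for the sunflower dichotomy `[t ≥ q ⇒ Ha ≥ 0] ∧ [q ≥ t ⇒ Hb ≥ 0]`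
(memo `run/shared/lean/prim/prim-ineq-prove-4/FROM-prim-cert-1-gen3-BERNSTEIN-GOOD.md`, Addendum 3). -/

/-- **Bernstein form of the one-coordinate identity for `F_c = c·(tq − e₂(u)) − e₃(u)`** with `c = κ_t·t + κ_q·q` any fixed
linear combination of the core and outside masses (`(κ_t,κ_q) = (1,0)`: `Ha`; `(0,1)`: `Hb`; `(1,1)`: `Hqt`):
`F_c(law p) = (1−p)³F₀ + 3p(1−p)²B₁ + 3p²(1−p)B₂ + p³F₁` with `3B₁ = (c₀+c₁)AG₀ + c₀AG₁ + c₀Γ − M₁` and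
`3B₂ = c₁AG₀ + (c₀+c₁)AG₁ + c₁Γ − M₂`. [this file] -/
theorem bernstein_identity_linear (κt κq p a₀ b₀ d cp₁ cp₂ cp₃ co₁ co₂ co₃ cm₁ cm₂ cm₃ : ℝ) :
    let pb := 1 - p
    let a₁ := a₀ + d + (cp₁ + cp₂ + cp₃)
    let q₀ := b₀ + d + (cm₁ + cm₂ + cm₃)
    let q₁ := b₀
    let x₁ := co₁ + cp₁
    let x₂ := co₂ + cp₂
    let x₃ := co₃ + cp₃
    let y₁ := co₁ + cm₁
    let y₂ := co₂ + cm₂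
    let y₃ := co₃ + cm₃
    let t := pb * a₀ + p * a₁
    let q := pb * q₀ + p * q₁
    let u₁ := pb * x₁ + p * y₁
    let u₂ := pb * x₂ + p * y₂
    let u₃ := pb * x₃ + p * y₃
    let α := d + (cp₁ + cp₂ + cp₃)
    let β := d + (cm₁ + cm₂ + cm₃)
    let δ₁ := cm₁ - cp₁
    let δ₂ := cm₂ - cp₂
    let δ₃ := cm₃ - cp₃
    let AG₀ := a₀ * q₀ - (x₁ * x₂ + x₁ * x₃ + x₂ * x₃)
    let AG₁ := a₁ * q₁ - (y₁ * y₂ + y₁ * y₃ + y₂ * y₃)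
    let c₀ := κt * a₀ + κq * q₀
    let c₁ := κt * a₁ + κq * q₁
    let F₀ := c₀ * AG₀ - x₁ * x₂ * x₃
    let F₁ := c₁ * AG₁ - y₁ * y₂ * y₃
    let Γ := α * β + (δ₁ * δ₂ + δ₁ * δ₃ + δ₂ * δ₃)
    let M₁ := x₁ * x₂ * y₃ + x₁ * y₂ * x₃ + y₁ * x₂ * x₃
    let M₂ := x₁ * y₂ * y₃ + y₁ * x₂ * y₃ + y₁ * y₂ * x₃
    let B₁ := ((c₀ + c₁) * AG₀ + c₀ * AG₁ + c₀ * Γ - M₁) / 3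
    let B₂ := (c₁ * AG₀ + (c₀ + c₁) * AG₁ + c₁ * Γ - M₂) / 3
    (κt * t + κq * q) * (t * q - (u₁ * u₂ + u₁ * u₃ + u₂ * u₃)) - u₁ * u₂ * u₃ =
      pb ^ 3 * F₀ + 3 * p * pb ^ 2 * B₁ + 3 * p ^ 2 * pb * B₂ + p ^ 3 * F₁ := by
  intro pb a₁ q₀ q₁ x₁ x₂ x₃ y₁ y₂ y₃ t q u₁ u₂ u₃ α β δ₁ δ₂ δ₃ AG₀ AG₁ c₀ c₁ F₀ F₁ Γ M₁ M₂ B₁ B₂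
  simp only [pb, a₁, q₀, q₁, x₁, x₂, x₃, y₁, y₂, y₃, t, q, u₁, u₂, u₃, α, β, δ₁, δ₂, δ₃, AG₀, AG₁, c₀, c₁, F₀, F₁, Γ, M₁, M₂,
    B₁, B₂]
  ring

/-- Nonnegativity of a cubic on a subinterval `[a,1]` from its de Casteljau (Bernstein) data there: if
`f(p) = (1−s)³d₀ + 3s(1−s)²d₁ + 3s²(1−s)d₂ + s³d₃` with `s = (p−a)/(1−a)` and all `dᵢ ≥ 0`, then `f(p) ≥ 0` for `p ∈ [a,1]`,
`a < 1`.  (Used for the mixed-regime half of the piecewise criterion: `Ha` on `[p*,1]`.) [folklore] -/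
theorem cubic_nonneg_on_subinterval {a p d₀ d₁ d₂ d₃ f : ℝ} (ha : a < 1) (hap : a ≤ p) (hp1 : p ≤ 1)
    (h0 : 0 ≤ d₀) (h1 : 0 ≤ d₁) (h2 : 0 ≤ d₂) (h3 : 0 ≤ d₃)
    (hf : f = (1 - (p - a) / (1 - a)) ^ 3 * d₀ + 3 * ((p - a) / (1 - a)) * (1 - (p - a) / (1 - a)) ^ 2 * d₁ +
      3 * ((p - a) / (1 - a)) ^ 2 * (1 - (p - a) / (1 - a)) * d₂ + ((p - a) / (1 - a)) ^ 3 * d₃) : 0 ≤ f := by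
  have h1a : 0 < 1 - a := by linarith
  have hs0 : 0 ≤ (p - a) / (1 - a) := div_nonneg (by linarith) h1a.le
  have hs1 : (p - a) / (1 - a) ≤ 1 := by
    rw [div_le_one h1a]; linarith
  rw [hf]
  exact cubic_bernstein_nonneg hs0 hs1 h0 h1 h2 h3

end SunflowerCubicBernstein

end Summit.CriticalPhenomena.PercolationContinuityZ3.Theorems
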